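import Summits.AnomalousDissipation.AnomalousDissipation.Theorems.QuarticGate.Negative.EnergyRow
import Summits.AnomalousDissipation.AnomalousDissipation.Theorems.MomentParityQuarticGateDesignSymShift
import Summits.AnomalousDissipation.AnomalousDissipation.Theorems.MomentParityGalerkinInvariantLoudStubShiftFamily
import Summits.AnomalousDissipation.AnomalousDissipation.Theorems.MomentParityGalerkinInvariantLoudStubHaarSymmetrise
import Literature.Analysis.FluidPDE.StokesTorusProofs

/-!
# Line `symmetrised-profile-frozen-quiet-split` — LEAD'S SKELETON (reshape r2) for the crux
# `MomentParity.GalerkinInvariantLoud` (stmt-AnomalousDissipation-14283, route MomentParity)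

Lead: prover-line-stmt-AnomalousDissipation-14283-c2-0 (continuation lead c2, 2026-08-17), from the planner's
checked skeleton `Cruxes/GalerkinInvariantLoud/Lines/symmetrised_profile_frozen_quiet_split.lean` (r1, 4 stubs).

**The line.** Fix the Kolmogorov force of wavenumber `m = 2`, `f_K = sin(4πx₁) e₀`
(`Torus.stokesMode (Pi.single 1 2) (EuclideanSpace.single 0 1) false`, written INLINE below: no line-local
definition, so every stub lands as a stand-alone `--supports` file). Invariant Galerkin laws can be averaged over
the 2-torus of translations `{c : c₁ = 0}` fixing `f_K` at no cost (Haar symmetrisation). The crux is then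
split along the alternative for ν-UNIFORMLY SUPPORT-BOUNDED symmetric invariant families as `ν → 0`:
either their large scales keep moving beyond rigid drift — then they must be loud (K1, the rigidity BET,
a conditional ν-uniform dissipation floor) — or no bounded family keeps moving, which K2 denies, resting on
the bare existence of a ν-uniformly bounded invariant family (K2a).

**Reshape r2 (this lead) vs the planner's r1.**
(a) NO line-local definitions: `kolForce2`, `IsTransSym`, `accelModDrift` are written inline (verbatim
    sub-terms), so no Defs module has to be reviewed before a stub can land (as c1 did for the conley line).
(b) The symmetrisation lever is SPLIT in two provable stubs over BUILT tree machinery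
    (`Theorems/MomentParityQuarticGateDesignSymShiftOp.lean`: shift homeomorphisms `T a : H ≃ₜ H`
    represented a.e. by `u ↦ u(· + a)`, with `pairing_shiftOp`, `nsGeneratorPairing_shiftOp`, `norm_shiftOp`,
    `eGradNormSq_shiftOp`, `isLevel_shiftOp_iff`, `isBandTest_comp_add_right`):
    S1 `stub_shiftFamily` — a JOINTLY CONTINUOUS shift family exists (Mathlib
    `MeasureTheory.Lp.compMeasurePreserving_continuous`); S2 `stub_haarSymmetrise` — for any such family and
    any smooth shear-invariant force, the Haar average `μ' = ∫_{T²} (T c)_* μ dc` of a bounded level-`N`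
    all-order-stationary law is a bounded level-`N` all-order-stationary law, translation-symmetric in law,
    with the same energy and dissipation. S2 is stated for a GENERAL shear-invariant smooth force (reusable).
(c) The symmetrisation is moved BEFORE the unfrozen selection: K2 (`stub_unfrozenBoundedSym`) now maps
    SYMMETRIC bounded families to SYMMETRIC bounded unfrozen families, so the symmetrisation stub no longer
    has to transport the acceleration-modulo-drift functional (r1's Parseval-frame covariance clause is gone;
    K2 is open physics either way and any mechanism for it can symmetrise its own output).
(d) K2a and K1 are the planner's, verbatim up to the inlining.

**Composition** `GalerkinInvariantLoud_of` (kernel-checked, no `sorry` of its own, uses the five registered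
stubs BY NAME and concludes the crux BY NAME): K2a ⇒ bounded family along `ν_j → 0⁺`; S1+S2 symmetrise each
law (same level, radius, stationarity); K2 ⇒ a symmetric bounded (`R₁`) family unfrozen modulo drift at
resolution `K₀`, rate `a₀`; K1 at `(R₁, K₀, a₀)` ⇒ `ε, ν₀`; re-index `ν'_j := ν_{j+J}` (`ν_j < ν₀` for
`j ≥ J`); at each `j`, K1's `N₀(ν'_j)` meets K2's frequently-many levels (`Frequently.and_eventually`);
K1 fires; energy `≤ R₁²` from the support bound; `E := R₁²`, `R := R₁`.

**Disproof used** (`Cruxes/GalerkinInvariantLoud/Disproof.lean` rev 5, NO KILL; landed `Negative/*`): no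
`_false_without_` theorem, no `-- Targets` kill against this line; the §2b load-bearing table is honoured clause
by clause (`0 < ε` from K1; ceiling `E := R₁²`; `ν_j → 0` from K2a; one explicit force — `not_gilEveryForce`;
`∃ᶠ N` unbounded in every stub — `not_gilBoundedLevel`, `eps_le_level` forces K1's `N₀ ≳ ν^{-1/2}`);
§3 `ae_norm_le_absorbing` (GIL's own radius is free, `≍ ν⁻¹`) is exactly why the ν-UNIFORM radius of
K2a/K2/K1 is a separate, honest hypothesis; §4 (atoms are Galerkin steady states, acceleration `0`) keeps
atomic laws out of K1's hypothesis and K2's conclusion; `isGILWitness_dirac_kolState` (laminar Dirac: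
symmetric, frozen, loud, FAT) is outside every stub by the support bound.
-/

noncomputable section

-- every `Summit.AnomalousDissipation.AnomalousDissipation.…` name repeats the summit = sub-problem segment
set_option linter.dupNamespace false

namespace Summit.AnomalousDissipation.AnomalousDissipation.Cruxes.GalerkinInvariantLoud.SymmetrisedProfileFrozenQuietSplit

open MeasureTheory Filter Topology
open scoped ENNReal InnerProductSpace RealInnerProductSpace
open Literature.Analysis.FunctionSpaces Literature.Analysis.FluidPDE
open Summit.AnomalousDissipation.AnomalousDissipation.Theses.MomentParity
open Summit.AnomalousDissipation.AnomalousDissipation.Theorems.QuarticGate.Negative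
open Summit.AnomalousDissipation.AnomalousDissipation.Theorems.CubicParityLoud.Negative
  (T3 R3 H3 L2T3 frameG)

/-! ## The force `f_K = sin(4πx₁)e₀` (inline `Torus.stokesMode (Pi.single 1 2) (EuclideanSpace.single 0 1) false`) -/

/-- The Kolmogorov frequency `(0,2,0)` is non-zero. [folklore] -/
theorem kolFreq2_ne_zero : (Pi.single 1 2 : Fin 3 → ℤ) ≠ 0 := fun h => by
  have := congrFun h 1; simp at this

/-- `f_K` is smooth. [folklore] -/
theorem isSmooth_kolForce2 :
    Torus.IsSmooth (Torus.stokesMode (d := Fin 3) (Pi.single 1 2) (EuclideanSpace.single 0 1) false) :=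
  Torus.isSmooth_stokesMode _ _ _

/-- `f_K` is divergence free (`(0,2,0) · e₀ = 0`). [folklore] -/
theorem isDivFree_kolForce2 :
    Torus.IsDivFree (Torus.stokesMode (d := Fin 3) (Pi.single 1 2) (EuclideanSpace.single 0 1) false) := by
  refine Torus.isDivFree_stokesMode ?_ false
  rw [EuclideanSpace.inner_single_right]
  simp [Torus.latticeVec_apply]

/-- `f_K` has zero mean. [folklore] -/
theorem hasZeroMean_kolForce2 :
    Torus.HasZeroMean (Torus.stokesMode (d := Fin 3) (Pi.single 1 2) (EuclideanSpace.single 0 1) false) :=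
  Torus.hasZeroMean_stokesMode kolFreq2_ne_zero _ _

/-- `f_K` is invariant under the shear group `{c : c₁ = 0}` (it depends on `x₁` only). [folklore] -/
theorem kolForce2_comp_add_right (c : T3) (hc : c 1 = 0) (x : T3) :
    Torus.stokesMode (d := Fin 3) (Pi.single 1 2) (EuclideanSpace.single 0 1) false (x + c) =
      Torus.stokesMode (d := Fin 3) (Pi.single 1 2) (EuclideanSpace.single 0 1) false x := by
  simp only [Torus.stokesMode_apply]
  rw [Torus.mFourier_apply_add,
    Theorems.MomentParityQuarticGate.mFourier_apply_eq_one_of_axial (k := (Pi.single 1 2 : Fin 3 → ℤ))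
      (by simp) (by simp) hc, mul_one]

/-! ## The registered stubs (K2a, S1, S2, K2, K1) — `sorry` only here -/

/-- **K2a · `stub_boundedFamily` — a `ν`-UNIFORMLY BOUNDED invariant family exists (size M–L as Lean,
OPEN as mathematics).** Viscosities `ν_j → 0⁺` and ONE radius `R₀` such that at every `j`, for infinitely
many Galerkin levels `N`, some probability law on `H` carried by level-`N` fields and supported in the
FIXED ball `‖u‖ ≤ R₀` is polynomially stationary at every order for Galerkin NS at `(ν_j, f_K)`. The
existential Galerkin form of the ensemble-ceiling question: no loudness, no unsteadiness. Not served by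
junk (`δ₀` is not stationary once `N ≥ 2`: the linear row on `f_K` reads `‖f_K‖² = ½`; the laminar Dirac
has radius `(16√2π²ν)⁻¹`; `∃ᶠ N` forbids bounded levels). By `Negative.steady_of_isInvariant_atomic` an
atomic witness is a family of Galerkin steady states of `f_K` bounded uniformly in `ν` at unboundedly many
levels — bounded steady branches of forced NS as `ν → 0` are open (Constantin–Tarfulea–Vicol 2013 §2);
diffuse witnesses are Krylov–Bogoliubov laws of orbits trapped in a `ν`-uniform ball — equally open. -/
theorem stub_boundedFamily :
    ∃ (ν : ℕ → ℝ) (R₀ : ℝ), (∀ j, 0 < ν j) ∧ Tendsto ν atTop (𝓝 0) ∧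
      ∀ j : ℕ, ∃ᶠ N in atTop, ∃ μ : Measure H3, IsProbabilityMeasure μ ∧ (∀ᵐ u ∂μ, IsLevel N u) ∧
        (∀ᵐ u ∂μ, ‖u‖ ≤ R₀) ∧
        (∀ d, IsPolyStationary (ν j)
          (Torus.stokesMode (d := Fin 3) (Pi.single 1 2) (EuclideanSpace.single 0 1) false) N d μ) := by
  sorry

/-- **S1 · `stub_shiftFamily` (LANDED p154247 as `Theorems.GalerkinInvariantLoud.ShiftFamily.stub_shiftFamily`) —
translations act on `H` by a JOINTLY CONTINUOUS family of homeomorphisms (size M).** There is `T : T³ → (H ≃ₜ H)` with `T a u` represented a.e. by `x ↦ u(x + a)`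
and `(a, u) ↦ T a u` continuous on `T³ × H`. Construction: `T a = Lp.compMeasurePreservingₗᵢ ℝ (· + a)`
restricted to `H` (exactly `MomentParityQuarticGateDesignSymShiftOp.exists_shiftOp`, whose proof shows `H`
is preserved and `T (−a)` inverts `T a`); joint continuity is Mathlib's
`MeasureTheory.Lp.compMeasurePreserving_continuous` / `Continuous.compMeasurePreservingLp` along the
continuous family of measure-preserving translations `a ↦ (· + a)` (pattern:
`Literature/Analysis/FunctionSpaces/BesovSliceMeasurability.lean`). [folklore] -/
theorem stub_shiftFamily :
    ∃ T : T3 → H3 ≃ₜ H3,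
      (∀ (a : T3) (u : H3), ((T a u).1 : T3 → R3) =ᵐ[volume] fun x => (u.1 : T3 → R3) (x + a)) ∧
      Continuous (fun p : T3 × H3 => T p.1 p.2) :=
  Theorems.GalerkinInvariantLoud.ShiftFamily.stub_shiftFamily

/-- **S2 · `stub_haarSymmetrise` (LANDED p155224 as `Theorems.GalerkinInvariantLoud.HaarSymmetrise.stub_haarSymmetrise`)
— Haar averaging over the shear torus is free (size L; the line's LEVER, stated for a general shear-invariant
smooth force).** Given a jointly continuous shift family
`T` as in S1, a smooth force invariant under `{c : c₁ = 0}`, and a probability law `μ` on `H` that is level-`N`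
carried, supported in `‖u‖ ≤ R` and polynomially stationary at every order for Galerkin NS at `(ν, f)`, the
law `μ' := (Haar_{T²} ⊗ μ) ∘ ((c, u) ↦ T (ι c) u)⁻¹` (`ι : 𝕋 × 𝕋 → T³`, `ι(a,b) = (a, 0, b)`, Haar = `volume`)
is a probability law, level-`N` carried (`isLevel_shiftOp_iff`), supported in the same ball (`norm_shiftOp`),
stationary at every order (each row of `(T c)_*μ` is the row of `μ` at the translated — again level-`N` band,
`isBandTest_comp_add_right` — tests, by `pairing_shiftOp` + `nsGeneratorPairing_shiftOp`; integrability on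
`T² ×` the compact level ball by continuity, `continuous_nsGeneratorPairing_polyGrad`; Fubini), TRANSLATION
SYMMETRIC IN LAW (every polynomial cylindrical moment with level-`N` band tests is unchanged under
`g ↦ g(· + c)`, `c₁ = 0`: `(T a u, g(· + c)) = (T (a − c) u, g)` and Haar invariance of `a ↦ a − c`,
`MeasurePreserving.integral_comp`), with the SAME mean energy (`‖T a u‖ = ‖u‖`) and dissipation
(`eGradNormSq_shiftOp`, `lintegral` Fubini). [folklore] -/
theorem stub_haarSymmetrise :
    ∀ (T : T3 → H3 ≃ₜ H3),
      (∀ (a : T3) (u : H3), ((T a u).1 : T3 → R3) =ᵐ[volume] fun x => (u.1 : T3 → R3) (x + a)) →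
      Continuous (fun p : T3 × H3 => T p.1 p.2) →
      ∀ (ν : ℝ) (f : T3 → R3) (N : ℕ) (R : ℝ) (μ : Measure H3), Torus.IsSmooth f →
        (∀ c : T3, c 1 = 0 → ∀ x, f (x + c) = f x) →
        IsProbabilityMeasure μ → (∀ᵐ u ∂μ, IsLevel N u) → (∀ᵐ u ∂μ, ‖u‖ ≤ R) →
        (∀ d, IsPolyStationary ν f N d μ) →
        ∃ μ' : Measure H3, IsProbabilityMeasure μ' ∧ (∀ᵐ u ∂μ', IsLevel N u) ∧ (∀ᵐ u ∂μ', ‖u‖ ≤ R) ∧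
          (∀ d, IsPolyStationary ν f N d μ') ∧
          (∀ c : T3, c 1 = 0 → ∀ (m : ℕ) (g : Fin m → T3 → R3) (P : MvPolynomial (Fin m) ℝ),
            (∀ i, IsBandTest N (g i)) →
              ∫ u, MvPolynomial.eval (fun i => Torus.pairing u.1 (g i)) P ∂μ' =
                ∫ u, MvPolynomial.eval (fun i => Torus.pairing u.1 (fun x => g i (x + c))) P ∂μ') ∧
          Torus.ensembleEnergy μ' = Torus.ensembleEnergy μ ∧
          Torus.ensembleDissipation ν μ' = Torus.ensembleDissipation ν μ :=
  Theorems.GalerkinInvariantLoud.HaarSymmetrise.stub_haarSymmetrise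

/-- **K2 · `stub_unfrozenBoundedSym` — non-laminarisation at bounded energy, symmetric form (size L–XL as
Lean, OPEN as mathematics).** Along any `ν_j → 0⁺`: if a `ν`-uniformly bounded, translation-symmetric (in
law) invariant family exists `N`-frequently (K2a's output after S1+S2), then such a family exists that is
UNFROZEN MODULO DRIFT, uniformly: one radius `R₁`, one resolution `K₀`, one `a₀ > 0` with mean-square
low-mode Galerkin acceleration modulo drift
`∫ inf_{c ∈ ℝ²} Σ_a (⟨F(u), e_a⟩ + c₁ (u, ∂₀e_a) + c₂ (u, ∂₂e_a))² dμ ≥ a₀` (`e_a` = the Galerkin frame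
`frameG K₀`; relative equilibria — Galerkin steady states, travelling waves — have acceleration `0`).
Mechanism the card proposes: instability of the bounded relative equilibria of `f_K` (Meshalkin–Sinai /
`friedlanderStraussVishik1997_prop51` for `sin(my)`, `m > 1`) ⇒ recurrence near them at bounded radius ⇒
bounded unfrozen invariant laws, symmetrised by S2. Why it might fail: relaminarisation onto relative
equilibria at bounded energy while all unsteady recurrence escapes to radii `→ ∞` (no DNS shows it, no
theorem forbids it). If the offered family is already unfrozen: nothing to do. -/
theorem stub_unfrozenBoundedSym :
    ∀ (ν : ℕ → ℝ) (R₀ : ℝ), (∀ j, 0 < ν j) → Tendsto ν atTop (𝓝 0) →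
      (∀ j : ℕ, ∃ᶠ N in atTop, ∃ μ : Measure H3, IsProbabilityMeasure μ ∧ (∀ᵐ u ∂μ, IsLevel N u) ∧
        (∀ᵐ u ∂μ, ‖u‖ ≤ R₀) ∧
        (∀ d, IsPolyStationary (ν j)
          (Torus.stokesMode (d := Fin 3) (Pi.single 1 2) (EuclideanSpace.single 0 1) false) N d μ) ∧
        (∀ c : T3, c 1 = 0 → ∀ (m : ℕ) (g : Fin m → T3 → R3) (P : MvPolynomial (Fin m) ℝ),
          (∀ i, IsBandTest N (g i)) →
            ∫ u, MvPolynomial.eval (fun i => Torus.pairing u.1 (g i)) P ∂μ =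
              ∫ u, MvPolynomial.eval (fun i => Torus.pairing u.1 (fun x => g i (x + c))) P ∂μ)) →
      ∃ (R₁ : ℝ) (K₀ : ℕ) (a₀ : ℝ), 0 < a₀ ∧ ∀ j : ℕ, ∃ᶠ N in atTop, ∃ μ : Measure H3,
        IsProbabilityMeasure μ ∧ (∀ᵐ u ∂μ, IsLevel N u) ∧ (∀ᵐ u ∂μ, ‖u‖ ≤ R₁) ∧
        (∀ d, IsPolyStationary (ν j)
          (Torus.stokesMode (d := Fin 3) (Pi.single 1 2) (EuclideanSpace.single 0 1) false) N d μ) ∧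
        (∀ c : T3, c 1 = 0 → ∀ (m : ℕ) (g : Fin m → T3 → R3) (P : MvPolynomial (Fin m) ℝ),
          (∀ i, IsBandTest N (g i)) →
            ∫ u, MvPolynomial.eval (fun i => Torus.pairing u.1 (g i)) P ∂μ =
              ∫ u, MvPolynomial.eval (fun i => Torus.pairing u.1 (fun x => g i (x + c))) P ∂μ) ∧
        a₀ ≤ ∫ u, ⨅ c : ℝ × ℝ, ∑ a, (Torus.nsGeneratorPairing (ν j)
              (Torus.stokesMode (d := Fin 3) (Pi.single 1 2) (EuclideanSpace.single 0 1) false) u (frameG K₀ a)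
            + c.1 * Torus.pairing u.1 (Torus.partialDeriv 0 (frameG K₀ a))
            + c.2 * Torus.pairing u.1 (Torus.partialDeriv 2 (frameG K₀ a))) ^ 2 ∂μ := by
  sorry

/-- **K1 · `stub_frozenQuiet` — QUIET ⇒ FROZEN (modulo drift), contrapositively a CONDITIONAL `ν`-UNIFORM
DISSIPATION FLOOR (size XL; the HARDEST stub, the line's BET; OPEN as mathematics).** For every radius `R₀`,
resolution `K` and rate `a₀ > 0` there are `ε > 0` and `ν₀ > 0` such that for every `ν ∈ (0, ν₀)`, beyond some
level `N₀(ν)` (`N₀ ≳ ν^{-1/2}` forced by `Negative.eps_le_level`), every translation-symmetric (in law)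
level-`N` invariant law of `(ν, f_K)` supported in `‖u‖ ≤ R₀` whose large scales move beyond drift
(acceleration modulo drift `≥ a₀` at resolution `K`) dissipates at least `ε`: `ν∫‖∇u‖²dμ ≥ ε`. Reading: by
`Negative.dissipation_eq` the dissipation IS the work `(f_K, ū) = ½Û₀,sin(2)` on the mean profile; a quiet
symmetric bounded family has zero mean flux through every wavenumber, vanishing mean shear and production,
and a Reynolds stress pinned to `−cos(4πx₁)/(4π) + c`; every known bounded inhabitant of that world is a
relative equilibrium, frozen modulo drift; K1 says there are no others in the closure of bounded invariant
Galerkin laws. Why it might fail: a smooth, bounded, workless but genuinely unsteady coherent object of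
forced Euler (relative periodic orbit / KAM torus around an elliptic dodger) that is the `ν → 0` limit of
invariant laws of NS_ν. Cheapest test-bed: planar laws (all quiet by `PlanarCubicQuiet`). -/
theorem stub_frozenQuiet :
    ∀ (R₀ : ℝ) (K : ℕ) (a₀ : ℝ), 0 < a₀ → ∃ ε : ℝ, 0 < ε ∧ ∃ ν₀ : ℝ, 0 < ν₀ ∧
      ∀ ν : ℝ, 0 < ν → ν < ν₀ → ∃ N₀ : ℕ, ∀ N : ℕ, N₀ ≤ N → ∀ μ : Measure H3,
        IsProbabilityMeasure μ → (∀ᵐ u ∂μ, IsLevel N u) → (∀ᵐ u ∂μ, ‖u‖ ≤ R₀) →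
        (∀ d, IsPolyStationary ν
          (Torus.stokesMode (d := Fin 3) (Pi.single 1 2) (EuclideanSpace.single 0 1) false) N d μ) →
        (∀ c : T3, c 1 = 0 → ∀ (m : ℕ) (g : Fin m → T3 → R3) (P : MvPolynomial (Fin m) ℝ),
          (∀ i, IsBandTest N (g i)) →
            ∫ u, MvPolynomial.eval (fun i => Torus.pairing u.1 (g i)) P ∂μ =
              ∫ u, MvPolynomial.eval (fun i => Torus.pairing u.1 (fun x => g i (x + c))) P ∂μ) →
        a₀ ≤ ∫ u, ⨅ c : ℝ × ℝ, ∑ a, (Torus.nsGeneratorPairing ν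
              (Torus.stokesMode (d := Fin 3) (Pi.single 1 2) (EuclideanSpace.single 0 1) false) u (frameG K a)
            + c.1 * Torus.pairing u.1 (Torus.partialDeriv 0 (frameG K a))
            + c.2 * Torus.pairing u.1 (Torus.partialDeriv 2 (frameG K a))) ^ 2 ∂μ →
        ε ≤ Torus.ensembleDissipation ν μ := by
  sorry

/-! ## The kernel-checked composition -/

/-- A probability law supported in the ball `‖u‖ ≤ R` has mean energy `≤ R²` (GIL's `ensembleEnergy μ ≤ E`
from the support bound, `E := R²`). [folklore] -/
theorem ensembleEnergy_le_sq_of_ae_le {μ : Measure H3} [IsProbabilityMeasure μ] {R : ℝ}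
    (hR : ∀ᵐ u ∂μ, ‖u‖ ≤ R) : Torus.ensembleEnergy μ ≤ R ^ 2 := by
  have hint : Integrable (fun u : H3 => ‖u‖ ^ 2) μ := by
    refine Integrable.mono' (integrable_const (max R 0 ^ 2)) (continuous_norm.pow 2).aestronglyMeasurable ?_
    filter_upwards [hR] with u hu
    rw [Real.norm_of_nonneg (by positivity)]
    exact pow_le_pow_left₀ (norm_nonneg _) (hu.trans (le_max_left _ _)) 2
  calc Torus.ensembleEnergy μ = ∫ u, ‖u‖ ^ 2 ∂μ := rfl
    _ ≤ ∫ _u, R ^ 2 ∂μ := by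
        refine integral_mono_ae hint (integrable_const _) ?_
        filter_upwards [hR] with u hu
        exact pow_le_pow_left₀ (norm_nonneg u) hu 2
    _ = R ^ 2 := by simp

/-- **Composition (no `sorry` of its own; uses the five registered stubs BY NAME and concludes the crux BY
NAME).** K2a ⇒ S1+S2 (symmetrise each bounded law: same level, radius, all-order stationarity) ⇒ K2
(symmetric bounded unfrozen family, `R₁, K₀, a₀`) ⇒ K1 at `(R₁, K₀, a₀)` (`ε, ν₀`); re-index the viscosities
past `ν₀`; at each `j` meet K1's `N₀` inside K2's `∃ᶠ N`; K1 fires; energy `≤ R₁²` from the support bound. -/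
theorem GalerkinInvariantLoud_of : GalerkinInvariantLoud := by
  have hA := stub_boundedFamily
  have hT := stub_shiftFamily
  have hS := stub_haarSymmetrise
  have hB := stub_unfrozenBoundedSym
  have hR := stub_frozenQuiet
  obtain ⟨T, hTae, hTc⟩ := hT
  obtain ⟨ν, R₀, hν, hν0, hfam⟩ := hA
  -- symmetrise the bounded family (S2 with the shift family of S1, at the force `f_K`)
  have hfamS : ∀ j : ℕ, ∃ᶠ N in atTop, ∃ μ : Measure H3, IsProbabilityMeasure μ ∧ (∀ᵐ u ∂μ, IsLevel N u) ∧
      (∀ᵐ u ∂μ, ‖u‖ ≤ R₀) ∧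
      (∀ d, IsPolyStationary (ν j)
        (Torus.stokesMode (d := Fin 3) (Pi.single 1 2) (EuclideanSpace.single 0 1) false) N d μ) ∧
      (∀ c : T3, c 1 = 0 → ∀ (m : ℕ) (g : Fin m → T3 → R3) (P : MvPolynomial (Fin m) ℝ),
        (∀ i, IsBandTest N (g i)) →
          ∫ u, MvPolynomial.eval (fun i => Torus.pairing u.1 (g i)) P ∂μ =
            ∫ u, MvPolynomial.eval (fun i => Torus.pairing u.1 (fun x => g i (x + c))) P ∂μ) := by
    intro j
    refine (hfam j).mono ?_
    rintro N ⟨μ, hp, hl, hRle, hst⟩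
    obtain ⟨μ', hp', hl', hR', hst', hsym, -, -⟩ :=
      hS T hTae hTc (ν j) _ N R₀ μ isSmooth_kolForce2 kolForce2_comp_add_right hp hl hRle hst
    exact ⟨μ', hp', hl', hR', hst', hsym⟩
  obtain ⟨R₁, K₀, a₀, ha₀, hunf⟩ := hB ν R₀ hν hν0 hfamS
  obtain ⟨ε, hε, ν₀, hν₀, hK1⟩ := hR R₁ K₀ a₀ ha₀
  obtain ⟨J, hJ⟩ : ∃ J : ℕ, ∀ j ≥ J, ν j < ν₀ :=
    Filter.eventually_atTop.1 (hν0.eventually (gt_mem_nhds hν₀))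
  refine ⟨_, isSmooth_kolForce2, isDivFree_kolForce2, hasZeroMean_kolForce2,
    fun j => ν (j + J), R₁ ^ 2, ε, fun j => hν _, hν0.comp (tendsto_add_atTop_nat J), hε,
    fun j => ⟨R₁, ?_⟩⟩
  obtain ⟨N₀, hN₀⟩ := hK1 (ν (j + J)) (hν _) (hJ _ (Nat.le_add_left J j))
  refine ((hunf (j + J)).and_eventually (eventually_ge_atTop N₀)).mono ?_
  rintro N ⟨⟨μ, hp, hl, hRle, hst, hsym, hacc⟩, hN⟩
  refine ⟨μ, hp, hl, hRle, fun m g P hg => hst (P.totalDegree + 1) m g P hg le_rfl, ?_, ?_⟩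
  · haveI := hp
    exact ensembleEnergy_le_sq_of_ae_le hRle
  · exact hN₀ N hN μ hp hl hRle hst hsym hacc

end Summit.AnomalousDissipation.AnomalousDissipation.Cruxes.GalerkinInvariantLoud.SymmetrisedProfileFrozenQuietSplit

end
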